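import Summits.Langlands.Langlands.Theorems.SoloInformedRepairD2Pst
import Summits.Langlands.Langlands.Theorems.SoloInformedRepairD2CrisGLOne
import Mathlib.LinearAlgebra.Dual.Lemmas
import HarnessLib

/-!
# Repair D2-pst — the Artin certificate: `D_{st,U}` of a representation trivial on `U`, and the
# Weil–Deligne operator as a representation of `W_F^{≤ 0}`, over the constructed `B_st(F)`

Companion to `Theorems/SoloInformedRepairD2Pst` (the clause `PstCompatibleAt`, typed over the constructed
`B_st(F) = B_max(F)[X]` with `D2Pst.DstOn ρ_v U = (ℚ̄_p^m ⊗ B_st(F))^U`, the residual action `actDstOn`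
and the Weil–Deligne operator `rDstOn ρ_v U f w = act_D(w) ∘ φ_D^{f·(-deg w)}`).  Two checks of that file's
NORMALISATION the kernel can perform today, with no admissibility theory.
* §1 `act_D` IS A REPRESENTATION (`actOn_mul`, `actDstOn_mul`, `actDstOn_one`), it commutes with the powers
  of `φ_D` (`actDstOn_comp_phiDstOn_pow`), and hence the Weil–Deligne operator is MULTIPLICATIVE on the
  submonoid `W_F^{≤ 0} = {deg ≤ 0}` (`rDstOn_mul_of_deg_nonpos`, given the tree's named facts `IsFrobPow.mul`,
  `IsFrobPow.unique` that make `deg` additive), which generates `W_F` as a group: the pointwise Jordan data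
  of clause (ii) of `PstCompatibleAt` (all `w` of degree `≤ 0`) are those of an honest representation of
  `W_F^{≤ 0}`, and of `W_F` itself as soon as `φ_D` is invertible (not claimed).
* §2 ARTIN PERIODS.  For a framed `ρ_v : Γ_F → GL_m(ℚ̄_p)` and a normal `U ≤ Γ_F` on which `ρ_v` is
  trivial (`hU : ∀ u ∈ U, ρ_v u = 1`; e.g. `ρ_v` an Artin representation, `U = Γ_L` for its splitting field
  `L`): the `ℚ̄_p`-linear ARTIN EMBEDDING `artinEmb : V = ℚ̄_p^m → D_{st,U}(ρ_v)`, `v ↦ v ⊗ 1`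
  (`tmul_one_mem_DstOn`), satisfies
  `act_D(g)(v ⊗ 1) = (ρ_v(g) v) ⊗ 1` (`actDstOn_artinEmb`: the descent datum on `V ⊗ 1` IS `ρ_v`),
  `φ_D(v ⊗ 1) = v ⊗ 1`, `N_D(v ⊗ 1) = 0` (`phiDstOn_artinEmb`, `NDstOn_artinEmb`; `N = -d/dX` kills `1`),
  hence `r_D(w)(v ⊗ 1) = (ρ_v(w) v) ⊗ 1` for EVERY `w ∈ W_F` and every `f` (`rDstOn_artinEmb`; at `m = 1`:
  `v ⊗ 1` is an `r_D(w)`-eigenvector of eigenvalue `χ(w)`, `rDstOn_artinEmb_one`), and `artinEmb` is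
  injective once Fontaine's `θ` is surjective (`artinEmb_injective`, from `D2Cris.nontrivial_bmax`).
So `D_{st,U}(ρ_v) ⊇ V ⊗ 1 ≅ V` with `(r_D, N_D)|_{V ⊗ 1} = (ρ_v|W_F, 0)`: in the normalisation of
`PstCompatibleAt`, the Weil–Deligne representation of an ARTIN representation is its restriction to the
Weil group with `N = 0` (Fontaine, Exp. VIII §2.3.7: `D_pst(V) = ℚ_p^nr ⊗ V` for `V` potentially
unramified… here potentially TRIVIAL, where no period beyond `1` is needed).  In the model
`D_{st,L}(ρ_v) = (L₀ ⊗ ℚ̄_ℓ)·(V ⊗ 1)` is `f_L` copies of `V`, so clause (ii) reads `d_D = f_L · d_{ρ_v|W}`,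
matched on the automorphic side by `rec(π_v) = ι ρ_v|W` — at `m = 1` this is local class field theory for a
finite-order Hecke character.  Consistency with D2-st: at `U = ⊤` the operator is `r_D(Frob_geom) = φ_D^f`
(`D2Pst.rDstOn_top_of_deg_eq_neg_one`), and for an UNRAMIFIED `ψ` the period is `e ⊗ u` with `u` a
Frobenius eigenvector, `φ^f = ψ(Frob_geom)` (kernel certificate for `ψ = ℚ_p(1)`:
`Theorems/SoloInformedRepairD2CrisGLOne`, `φ = p⁻¹` on `e ⊗ t⁻¹`) — the same value `ψ(w)` as here, on a
different period.  NOT claimed: that `V ⊗ 1` generates `D_{st,U}(ρ_v)` over `B_st^U` (`= L₀`,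
Fontaine–Colmez), any rank statement, or the Jordan-datum identity of clause (ii) itself.
-/

noncomputable section

open scoped MatrixGroups Matrix TensorProduct Polynomial
open Field Polynomial
open Literature.NumberTheory.GaloisRepresentations Literature.NumberTheory.PAdicHodge

namespace Summit.Langlands.Langlands.Theorems

namespace D2Pst

open D2Cris D2St

/-! ### §1 `act_D` is a representation; `r_D` is multiplicative on `W_F^{≤ 0}` -/

section Abstract

variable {p : ℕ} [Fact p.Prime] {E : Type*} [Field E] [Algebra ℚ_[p] E]
  {Γ : Type*} [Group Γ] {B : Type*} [CommRing B] [Algebra ℚ_[p] B] {m : ℕ}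

/-- The residual action is multiplicative: `act_D(gh) = act_D(g) ∘ act_D(h)`. [folklore] -/
theorem actOn_mul (ρ : Γ → GL (Fin m) E) (gal : Γ → (B →ₐ[ℚ_[p]] B))
    (hρ : ∀ σ τ, ρ (σ * τ) = ρ σ * ρ τ) (hgal : ∀ σ τ, gal (σ * τ) = (gal σ).comp (gal τ))
    (U : Subgroup Γ) [U.Normal] (g h : Γ) :
    actOn ρ gal hρ hgal U (g * h) = actOn ρ gal hρ hgal U g ∘ₗ actOn (E := E) ρ gal hρ hgal U h :=
  LinearMap.ext fun x => Subtype.ext (by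
    change diagAct ρ gal (g * h) (x : (Fin m → E) ⊗[ℚ_[p]] B) =
      diagAct ρ gal g (diagAct ρ gal h (x : (Fin m → E) ⊗[ℚ_[p]] B))
    rw [diagAct_mul ρ gal hρ hgal, LinearMap.comp_apply])

/-- The residual action of `1 ∈ U` is the identity. [folklore] -/
theorem actOn_one (ρ : Γ → GL (Fin m) E) (gal : Γ → (B →ₐ[ℚ_[p]] B))
    (hρ : ∀ σ τ, ρ (σ * τ) = ρ σ * ρ τ) (hgal : ∀ σ τ, gal (σ * τ) = (gal σ).comp (gal τ))
    (U : Subgroup Γ) [U.Normal] : actOn ρ gal hρ hgal U 1 = (1 : Module.End E (invariantsOn ρ gal U)) :=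
  LinearMap.ext fun x => actOn_apply_of_mem ρ gal hρ hgal U U.one_mem x

omit [Group Γ] in
/-- The diagonal action on an Artin period: `σ(v ⊗ 1) = (ρ(σ) v) ⊗ 1`. [folklore] -/
theorem diagAct_tmul_one (ρ : Γ → GL (Fin m) E) (gal : Γ → (B →ₐ[ℚ_[p]] B)) (σ : Γ) (v : Fin m → E) :
    diagAct ρ gal σ (v ⊗ₜ[ℚ_[p]] (1 : B)) =
      (Matrix.toLin' ((ρ σ : GL (Fin m) E) : Matrix (Fin m) (Fin m) E) v) ⊗ₜ[ℚ_[p]] (1 : B) := by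
  simp only [diagAct, TensorProduct.AlgebraTensorModule.map_tmul, AlgHom.toLinearMap_apply, map_one]

/-- `(1 ⊗ φ)(v ⊗ 1) = v ⊗ 1` for an algebra map `φ`. [folklore] -/
theorem phiTensor_tmul_one (φ : B →ₐ[ℚ_[p]] B) (v : Fin m → E) :
    phiTensor (E := E) φ (v ⊗ₜ[ℚ_[p]] (1 : B)) = v ⊗ₜ[ℚ_[p]] (1 : B) := by
  simp only [phiTensor, TensorProduct.AlgebraTensorModule.map_tmul, LinearMap.id_apply,
    AlgHom.toLinearMap_apply, map_one]

/-- `(1 ⊗ f)(v ⊗ b) = v ⊗ f b`. [folklore] -/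
theorem endTensor_tmul (f : B →ₗ[ℚ_[p]] B) (v : Fin m → E) (b : B) :
    endTensor (E := E) f (v ⊗ₜ[ℚ_[p]] b) = v ⊗ₜ[ℚ_[p]] f b := by
  simp only [endTensor, TensorProduct.AlgebraTensorModule.map_tmul, LinearMap.id_apply]

/-- **Artin periods are invariant**: `v ⊗ 1 ∈ (E^m ⊗ B)^U` when `ρ` is trivial on `U`.
[cite: FontaineAsterisque223VIII, Exp. VIII §2.3.7] -/
theorem tmul_one_mem_invariantsOn (ρ : Γ → GL (Fin m) E) (gal : Γ → (B →ₐ[ℚ_[p]] B)) (U : Subgroup Γ)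
    (hU : ∀ u ∈ U, ρ u = 1) (v : Fin m → E) : v ⊗ₜ[ℚ_[p]] (1 : B) ∈ invariantsOn ρ gal U :=
  (mem_invariantsOn_iff ρ gal U _).2 fun u hu => by
    rw [diagAct_tmul_one, hU u hu, Units.val_one, Matrix.toLin'_one, LinearMap.id_apply]

/-- `v ⊗ 1 ≠ 0` in `E^m ⊗_{ℚ_p} B` for `v ≠ 0` and `B ≠ 0` (test against `φ ⊗ ψ`, `φ v = ψ 1 = 1`).
[folklore] -/
theorem tmul_one_ne_zero [Nontrivial B] {v : Fin m → E} (hv : v ≠ 0) : v ⊗ₜ[ℚ_[p]] (1 : B) ≠ 0 := by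
  intro h
  obtain ⟨φ, hφ⟩ := Module.Projective.exists_dual_eq_one ℚ_[p] hv
  obtain ⟨ψ, hψ⟩ := Module.Projective.exists_dual_eq_one ℚ_[p] (one_ne_zero : (1 : B) ≠ 0)
  have := congrArg (fun x => TensorProduct.lid ℚ_[p] ℚ_[p] (TensorProduct.map φ ψ x)) h
  simp only [TensorProduct.map_tmul, TensorProduct.lid_tmul, hφ, hψ, smul_eq_mul, mul_one,
    map_zero] at this
  exact one_ne_zero this

end Abstract

/-! ### §2 Over the constructed `B_st(F)`: multiplicativity of `r_D`, and the Artin embedding -/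

section Bst

variable {F : Type} [Field F] [ValuativeRel F] [TopologicalSpace F] [IsNonarchimedeanLocalField F]
  [CharZero F] {p : ℕ} [Fact p.Prime] [Fact (¬ IsUnit (p : integerC F))]
  [IsAdicComplete (Ideal.span {(p : integerC F)}) (integerC F)]

/-- **`act_D` on `D_{st,U}(ρ_v)` is a representation of `Γ_F`** (through `Γ_F/U`). [folklore] -/
theorem actDstOn_mul {m : ℕ} (ρv : FramedRep (absoluteGaloisGroup F) (PadicAlgCl p) m)
    (U : Subgroup (absoluteGaloisGroup F)) [U.Normal] (g h : absoluteGaloisGroup F) :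
    actDstOn ρv U (g * h) = actDstOn ρv U g ∘ₗ actDstOn ρv U h :=
  actOn_mul _ _ _ _ U g h

/-- `act_D(1) = 1`. [folklore] -/
theorem actDstOn_one {m : ℕ} (ρv : FramedRep (absoluteGaloisGroup F) (PadicAlgCl p) m)
    (U : Subgroup (absoluteGaloisGroup F)) [U.Normal] :
    actDstOn ρv U 1 = (1 : Module.End (PadicAlgCl p) (DstOn ρv U)) :=
  LinearMap.ext fun x => actDstOn_apply_of_mem ρv U U.one_mem x

/-- `act_D(g)` commutes with every power of `φ_D`. [folklore] -/
theorem actDstOn_comp_phiDstOn_pow {m : ℕ} (ρv : FramedRep (absoluteGaloisGroup F) (PadicAlgCl p) m)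
    (U : Subgroup (absoluteGaloisGroup F)) [U.Normal] (g : absoluteGaloisGroup F) (k : ℕ) :
    actDstOn ρv U g ∘ₗ (phiDstOn ρv U ^ k) = (phiDstOn ρv U ^ k) ∘ₗ actDstOn ρv U g := by
  induction k with
  | zero => rw [pow_zero, Module.End.one_eq_id, LinearMap.comp_id, LinearMap.id_comp]
  | succ k ih =>
    rw [pow_succ, Module.End.mul_eq_comp, ← LinearMap.comp_assoc, ih, LinearMap.comp_assoc,
      actDstOn_comp_phiDstOn, ← LinearMap.comp_assoc]

/-- **The Weil–Deligne operator is multiplicative on `W_F^{≤ 0}`**: `r_D(w₁ w₂) = r_D(w₁) r_D(w₂)` for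
`deg w₁, deg w₂ ≤ 0` (`act_D(w₂)` commutes with `φ_D^{f(-deg w₁)}`; `deg` additive by the tree's named facts
`IsFrobPow.mul`, `IsFrobPow.unique`). [cite: FontaineAsterisque223VIII, Exp. VIII §2.3.7]
[cite: TateCorvallis1979, (4.1.2)] -/
theorem rDstOn_mul_of_deg_nonpos (hmul : IsFrobPow.mul (F := F)) (huniq : IsFrobPow.unique (F := F))
    {m : ℕ} (ρv : FramedRep (absoluteGaloisGroup F) (PadicAlgCl p) m)
    (U : Subgroup (absoluteGaloisGroup F)) [U.Normal] (f : ℕ) {w₁ w₂ : WeilGroup F}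
    (h₁ : WeilGroup.deg w₁ ≤ 0) (h₂ : WeilGroup.deg w₂ ≤ 0) :
    rDstOn ρv U f (w₁ * w₂) = rDstOn ρv U f w₁ ∘ₗ rDstOn ρv U f w₂ := by
  have hnat : (-WeilGroup.deg (w₁ * w₂)).toNat = (-WeilGroup.deg w₁).toNat + (-WeilGroup.deg w₂).toNat := by
    rw [WeilGroup.deg_mul hmul huniq, neg_add, Int.toNat_add (neg_nonneg.2 h₁) (neg_nonneg.2 h₂)]
  have hc := actDstOn_comp_phiDstOn_pow ρv U (WeilGroup.toAbsGalois F w₂) (f * (-WeilGroup.deg w₁).toNat)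
  simp only [rDstOn, hnat, map_mul, actDstOn_mul, mul_add, pow_add, Module.End.mul_eq_comp,
    LinearMap.comp_assoc]
  rw [← LinearMap.comp_assoc (phiDstOn ρv U ^ (f * (-WeilGroup.deg w₂).toNat))
    (actDstOn ρv U (WeilGroup.toAbsGalois F w₂)) (phiDstOn ρv U ^ (f * (-WeilGroup.deg w₁).toNat)), ← hc,
    LinearMap.comp_assoc]

/-- **Artin periods**: `v ⊗ 1 ∈ D_{st,U}(ρ_v)` when `ρ_v` is trivial on `U`.
[cite: FontaineAsterisque223VIII, Exp. VIII §2.3.7] -/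
theorem tmul_one_mem_DstOn {m : ℕ} (ρv : FramedRep (absoluteGaloisGroup F) (PadicAlgCl p) m)
    (U : Subgroup (absoluteGaloisGroup F)) (hU : ∀ u ∈ U, ρv u = 1) (v : Fin m → PadicAlgCl p) :
    v ⊗ₜ[ℚ_[p]] (1 : (Bmax F p)[X]) ∈ DstOn ρv U :=
  tmul_one_mem_invariantsOn _ _ U hU v

/-- **The Artin embedding** `V = ℚ̄_p^m → D_{st,U}(ρ_v)`, `v ↦ v ⊗ 1` (`ℚ̄_p`-linear), for `ρ_v` trivial
on `U`. [cite: FontaineAsterisque223VIII, Exp. VIII §2.3.7] -/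
def artinEmb {m : ℕ} (ρv : FramedRep (absoluteGaloisGroup F) (PadicAlgCl p) m)
    (U : Subgroup (absoluteGaloisGroup F)) (hU : ∀ u ∈ U, ρv u = 1) :
    (Fin m → PadicAlgCl p) →ₗ[PadicAlgCl p] DstOn ρv U where
  toFun v := ⟨v ⊗ₜ[ℚ_[p]] (1 : (Bmax F p)[X]), tmul_one_mem_DstOn ρv U hU v⟩
  map_add' v w := Subtype.ext (TensorProduct.add_tmul v w _)
  map_smul' c v := by
    refine Subtype.ext ?_
    change (c • v) ⊗ₜ[ℚ_[p]] (1 : (Bmax F p)[X]) = c • (v ⊗ₜ[ℚ_[p]] (1 : (Bmax F p)[X]))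
    exact (TensorProduct.smul_tmul' c v _).symm

/-- Unfolding lemma for `artinEmb`. [folklore] -/
@[simp] theorem artinEmb_apply_coe {m : ℕ} (ρv : FramedRep (absoluteGaloisGroup F) (PadicAlgCl p) m)
    (U : Subgroup (absoluteGaloisGroup F)) (hU : ∀ u ∈ U, ρv u = 1) (v : Fin m → PadicAlgCl p) :
    (artinEmb ρv U hU v : (Fin m → PadicAlgCl p) ⊗[ℚ_[p]] (Bmax F p)[X]) = v ⊗ₜ[ℚ_[p]] 1 := rfl

/-- **The descent datum on Artin periods is `ρ_v`**: `act_D(g)(v ⊗ 1) = (ρ_v(g) v) ⊗ 1`.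
[cite: FontaineAsterisque223VIII, Exp. VIII §2.3.7] -/
theorem actDstOn_artinEmb {m : ℕ} (ρv : FramedRep (absoluteGaloisGroup F) (PadicAlgCl p) m)
    (U : Subgroup (absoluteGaloisGroup F)) [U.Normal] (hU : ∀ u ∈ U, ρv u = 1)
    (g : absoluteGaloisGroup F) (v : Fin m → PadicAlgCl p) :
    actDstOn ρv U g (artinEmb ρv U hU v) = artinEmb ρv U hU
      (Matrix.toLin' ((ρv g : GL (Fin m) (PadicAlgCl p)) : Matrix (Fin m) (Fin m) (PadicAlgCl p)) v) :=
  Subtype.ext (diagAct_tmul_one _ _ g v)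

/-- `φ_D` fixes Artin periods (`φ 1 = 1`). [folklore] -/
theorem phiDstOn_artinEmb {m : ℕ} (ρv : FramedRep (absoluteGaloisGroup F) (PadicAlgCl p) m)
    (U : Subgroup (absoluteGaloisGroup F)) (hU : ∀ u ∈ U, ρv u = 1) (v : Fin m → PadicAlgCl p) :
    phiDstOn ρv U (artinEmb ρv U hU v) = artinEmb ρv U hU v :=
  Subtype.ext (phiTensor_tmul_one _ v)

/-- `φ_D^k` fixes Artin periods. [folklore] -/
theorem phiDstOn_pow_artinEmb {m : ℕ} (ρv : FramedRep (absoluteGaloisGroup F) (PadicAlgCl p) m)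
    (U : Subgroup (absoluteGaloisGroup F)) (hU : ∀ u ∈ U, ρv u = 1) (k : ℕ) (v : Fin m → PadicAlgCl p) :
    (phiDstOn ρv U ^ k) (artinEmb ρv U hU v) = artinEmb ρv U hU v := by
  induction k with
  | zero => rw [pow_zero, Module.End.one_apply]
  | succ k ih => rw [pow_succ, Module.End.mul_apply, phiDstOn_artinEmb, ih]

/-- `N_D` kills Artin periods (`N = -d/dX`, `N 1 = 0`). [folklore] -/
theorem NDstOn_artinEmb {m : ℕ} (ρv : FramedRep (absoluteGaloisGroup F) (PadicAlgCl p) m)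
    (U : Subgroup (absoluteGaloisGroup F)) (hU : ∀ u ∈ U, ρv u = 1) (v : Fin m → PadicAlgCl p) :
    NDstOn ρv U (artinEmb ρv U hU v) = 0 :=
  Subtype.ext (by
    change endTensor (NBst F p) (v ⊗ₜ[ℚ_[p]] (1 : (Bmax F p)[X])) = 0
    rw [endTensor_tmul, NBst_apply, derivative_one, neg_zero, TensorProduct.tmul_zero])

/-- **The Weil–Deligne operator on Artin periods is `ρ_v|W_F`**: `r_D(w)(v ⊗ 1) = (ρ_v(w) v) ⊗ 1` for
EVERY `w ∈ W_F` and every `f` (no degree restriction: `φ_D` fixes `v ⊗ 1`).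
[cite: FontaineAsterisque223VIII, Exp. VIII §2.3.7] [cite: BuzzardGeeLMS2014, §3.2] -/
theorem rDstOn_artinEmb {m : ℕ} (ρv : FramedRep (absoluteGaloisGroup F) (PadicAlgCl p) m)
    (U : Subgroup (absoluteGaloisGroup F)) [U.Normal] (hU : ∀ u ∈ U, ρv u = 1) (f : ℕ) (w : WeilGroup F)
    (v : Fin m → PadicAlgCl p) :
    rDstOn ρv U f w (artinEmb ρv U hU v) = artinEmb ρv U hU
      (Matrix.toLin' ((ρv (WeilGroup.toAbsGalois F w) : GL (Fin m) (PadicAlgCl p)) :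
        Matrix (Fin m) (Fin m) (PadicAlgCl p)) v) := by
  rw [rDstOn, LinearMap.comp_apply, phiDstOn_pow_artinEmb, actDstOn_artinEmb]

/-- At `m = 1`: every Artin period is an `r_D(w)`-eigenvector of eigenvalue `χ(w) = ρ_v(w)₀₀` (and `N_D`
kills it): the Weil–Deligne representation of a potentially trivial character `χ` is `(χ|W_F, 0)` — the
`GL_1` (local class field theory) case of clause (ii). [cite: BuzzardGeeLMS2014, §3.2] -/
theorem rDstOn_artinEmb_one (ρv : FramedRep (absoluteGaloisGroup F) (PadicAlgCl p) 1)
    (U : Subgroup (absoluteGaloisGroup F)) [U.Normal] (hU : ∀ u ∈ U, ρv u = 1) (f : ℕ) (w : WeilGroup F)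
    (v : Fin 1 → PadicAlgCl p) :
    rDstOn ρv U f w (artinEmb ρv U hU v) =
      ((ρv (WeilGroup.toAbsGalois F w) : GL (Fin 1) (PadicAlgCl p)) : Matrix (Fin 1) (Fin 1) (PadicAlgCl p))
        0 0 • artinEmb ρv U hU v := by
  rw [rDstOn_artinEmb, ← map_smul]
  congr 1
  ext i
  fin_cases i
  simp [Matrix.toLin'_apply, Matrix.mulVec, dotProduct]

/-- **`artinEmb` is injective** once Fontaine's `θ` is surjective (`B_st(F) = B_max(F)[X] ≠ 0` by
`D2Cris.nontrivial_bmax`): `D_{st,U}(ρ_v)` contains a copy of `V` on which `(r_D, N_D) = (ρ_v|W_F, 0)`.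
[cite: Colmez1998Annals, §III.2] -/
theorem artinEmb_injective {m : ℕ} (ρv : FramedRep (absoluteGaloisGroup F) (PadicAlgCl p) m)
    (U : Subgroup (absoluteGaloisGroup F)) (hU : ∀ u ∈ U, ρv u = 1)
    (hF : Function.Surjective (WittVector.fontaineTheta (integerC F) p)) :
    Function.Injective (artinEmb ρv U hU) := by
  haveI := nontrivial_bmax (F := F) (p := p) hF
  refine (injective_iff_map_eq_zero _).2 fun v hv => by_contra fun hne => ?_
  have h0 : v ⊗ₜ[ℚ_[p]] (1 : (Bmax F p)[X]) = 0 := congrArg Subtype.val hv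
  exact tmul_one_ne_zero hne h0

end Bst

end D2Pst

end Summit.Langlands.Langlands.Theorems

end
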